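import Summits.BirchSwinnertonDyer.Rank1Residual.X1.RankZeroDoubleTwist
import HarnessLib

/-!
# Residual class X1 ∩ {r = 0}: the DOUBLE-TWIST road, class form — any leaf pair by Cassels, Mazur's
# main conjecture, and the rider `DoubleTwistShaAnUnitSupply` (route (B-ii) of the cell, class-wide)

HONEST FRAMING (cell `bsd-eis`, home `run/shared/lean/pub/bsd-eis/`, seat `bsd-eis-k5-c5` (g2);
FULL-BSD rank-≤1 programme, ladder row A3 = class X1 ∩ {r_an = 0}; crux 5 `MazurMCOnX1RankZero` of
route `EisensteinPrimes`, item stmt-BirchSwinnertonDyer-19035). Nothing here closes the item and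
nothing is booked; no label moves. Sequel of `X1/RankZeroDoubleTwist.lean` (this seat): there,
`BSD(E',p)` at a good-lattice leaf pair is derived from Keller–Yin's IMC2 at `𝟙` (`h308`, PREPRINT,
the body of crux 2) used at BOTH admissible twists and `BSD` at one curve isogenous to an admissible
DOUBLE twist (per-pair certificate datum `DoubleTwistPartnerAt`: two admissible fields, a rank-one
partner, a rank-zero double twist and a `p ∤ #Ш_an` certificate on an isogenous curve — Wuthrich 2014
Prop. 21). Here: §1 the transport to ANY leaf pair (Cassels; the good lattice exists by Ribet's lemma,
tree theorem) and Mazur's main conjecture there (Wuthrich Thm. 16 + Greenberg Thm. 4.1 converse chain,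
x1b); §2 ONE class-wide rider spelled from the datum — `DoubleTwistShaAnUnitSupply` (`@[conjecture]`:
"every rank-`0` leaf pair has a good lattice carrying the double-twist certificate"; NOT in print as
stated — nearest print: Vatsal, Duke Math. J. 98 (1999): `p`-unit twisted central values from
Eisenstein congruences for semistable curves with a rational `p`-torsion point; Ono–Skinner, Ann. of
Math. 147 (1998): all but finitely many `p`; Beckwith–Raum–Richter, IMRN 2024: class numbers prime to
`ℓ` with prescribed splitting; Kriz–Li, Forum Math. Sigma 7 (2019)) — and the leaf statement
`X1.RankZero.Statement` / Mazur's main conjecture at every rank-`0` leaf pair from `h308` + the rider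
+ PUB: NO Schneider certificate, NO Greenberg–Vatsal, NO `p`-adic height, NO cyclotomic main
conjecture at type A. In route `EisensteinPrimes` the rider can stand in for crux 6
`SchneiderOnX1TypeB` on row A3 and on the whole X1 conjunct (companion
`Theorems/EisensteinPrimesMazurMCOnX1RankZeroDoubleTwist.lean`).
* §1 `Leaf.bsdp_of_isIsogenous_goodLattice_of_h308_of_doubleTwistPartnerAt`,
  `Leaf.mazurMainConjecture_of_isIsogenous_goodLattice_of_h308_of_doubleTwistPartnerAt`.
* §2 `DoubleTwistShaAnUnitSupply` (TYPED rider), `Leaf.bsdp_of_h308_of_doubleTwistSupply`,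
  `Leaf.mazurMainConjecture_of_h308_of_doubleTwistSupply`, `statement_of_h308_of_doubleTwistSupply`.
References: [KellerYin2024] Thm. 3.0.8 (IMC2), proof of Thm. 4.2.1; [Wuthrich2014] Thm. 16, Prop. 21;
[GreenbergLNM1716] Thm. 4.1; [MilneADT2006] I.7.3; [Vatsal1999Duke]; [OnoSkinner1998];
[BeckwithRaumRichter2024]; HOME/bsd-eis-ky-MEMO-1.md §5.2 (Theorem B, route (B-ii)); HOME/TARGET.md §1.1.
-/

set_option autoImplicit false

noncomputable section

open scoped Classical

open WeierstrassCurve NumberField IsDedekindDomain Field Literature.NumberTheory.EllipticCurves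
  Literature.NumberTheory.EllipticCurves.ModularForms Literature.NumberTheory.QuadraticFields
  Literature.NumberTheory.EllipticCurves.Rank1Residual
  Literature.NumberTheory.GaloisRepresentations
  Literature.NumberTheory.EllipticCurves.CastellaGrossiLeeSkinner2022
  Literature.NumberTheory.EllipticCurves.KellerYin2024
  Summit.BirchSwinnertonDyer.Rank1Residual.X1.KellerYinGoodLattice
  Summit.BirchSwinnertonDyer.Rank1Residual.X1.KellerYinTheoremA
  Summit.BirchSwinnertonDyer.Rank1Residual.X1.RankZeroDoubleTwist
  Summit.BirchSwinnertonDyer.BirchSwinnertonDyer.Theorems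
  Summit.BirchSwinnertonDyer.BirchSwinnertonDyer.Theorems.Rank1ResidualX1Defs
  Summit.BirchSwinnertonDyer.BirchSwinnertonDyer.Theorems.Rank1ResidualX1RankZeroTwist

namespace Summit.BirchSwinnertonDyer.Rank1Residual.X1.RankZeroDoubleTwistClass

variable {p : ℕ} [Fact p.Prime]

/-! ## §1 Any leaf pair: `BSD(E,p)` by Cassels and Mazur's main conjecture by the converse chain -/

/-- **`BSD(E,p)` at ANY leaf pair from an ISOGENOUS good lattice carrying the double-twist
certificate** (Cassels `hCassels` carries `BSD` back along the isogeny; the leaf transports: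
`ClassX1.of_isIsogenous`, `analyticRank_eq_of_isIsogenous'`; the good lattice of the class exists by
the tree's Ribet-lemma theorem `GoodLatticeExists.ribet_exists_isIsogenous_noUnramifiedLine_holds`).
This is the per-pair CURRENCY of the road: (⋆) = `h308` [PRE] · two admissible fields + one exact
`#Ш_an` [CERT] · [PUB]. [claim: KellerYin2024, status: under-review]
[cite: KellerYin2024, Thm. 3.0.8 (IMC2), Prop. 1.3.1] [cite: MilneADT2006, Thm. I.7.3]
[cite: Wuthrich2014, Prop. 21 (p. 400)] -/
theorem Leaf.bsdp_of_isIsogenous_goodLattice_of_h308_of_doubleTwistPartnerAt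
    (h308 : thm308_imc2_bdpValue_goodLattice_OPEN) (h511 : thm511_anticyclotomicControl_of_torsionFree)
    (hW : Wuthrich2014.sha_dvd_analyticSha) (hCassels : bsdRHS_eq_of_isIsogenous)
    (hmodP : nonempty_modularParametrizationData) (hmod : exists_isNewformOf)
    (hGZQ : GrossZagier1986_thm_I_7_3)
    (hGZ : ∀ (N : ℕ) [NeZero N] (W : WeierstrassCurve ℚ) (K : Type) [Field K] [NumberField K],
      gross_zagier N W K)
    (hKo : ∀ (N : ℕ) [NeZero N] (W : WeierstrassCurve ℚ) (K : Type) [Field K] [NumberField K],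
      kolyvagin N W K)
    (hGZK : rank_eq_analyticRank_of_analyticRank_le_one)
    (V : WeierstrassCurve ℚ) [V.IsElliptic] [V.IsGloballyMinimal] (hL : RankZero.Leaf V p)
    (W : WeierstrassCurve ℚ) [W.IsElliptic] [W.IsGloballyMinimal] (hiso : IsIsogenous V W)
    (hGL : ∀ Φ : AddSubgroup (geomTorsion W (p : ℤ)), IsRationalLine W p Φ → ¬ LineUnramifiedAt W p Φ)
    (hDT : DoubleTwistPartnerAt W p) : BSDp V p := by
  have hX1' : ClassX1 W p := ClassX1.of_isIsogenous hiso hL.classX1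
  have hr' : W.analyticRank = 0 :=
    (analyticRank_eq_of_isIsogenous' hiso).symm.trans hL.analyticRank_eq_zero
  have hB' : BSDp W p := Leaf.bsdp_goodLattice_of_h308_of_doubleTwistPartnerAt h308 h511 hW hCassels
    hmodP hmod hGZQ hGZ hKo hGZK W ⟨hX1', hr'⟩ hGL hDT
  obtain ⟨-, hfin'⟩ := hGZK W (by omega)
  have hlead' : W.leadingLCoeff ≠ 0 :=
    WeierstrassCurve.leadingLCoeff_ne_zero_holds (hasEntireLFunction_rat_of_exists_isNewformOf hmod W)
  exact Wuthrich2014.bsdp_of_isIsogenous hCassels hiso hfin' hlead' hB'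

/-- **Mazur's main conjecture at ANY leaf pair from the same data** (+ Wuthrich Thm. 16 `hW16` and
Greenberg Thm. 4.1 `hGr` for the converse chain `RankZero.Leaf.mazurMainConjecture_iff_bsdp`).
[cite: Wuthrich2014, Thm. 16 (p. 397), Prop. 21 (p. 400)] [cite: GreenbergLNM1716, Thm. 4.1]
[cite: KellerYin2024, Thm. 3.0.8 (IMC2)] -/
theorem Leaf.mazurMainConjecture_of_isIsogenous_goodLattice_of_h308_of_doubleTwistPartnerAt
    (h308 : thm308_imc2_bdpValue_goodLattice_OPEN) (h511 : thm511_anticyclotomicControl_of_torsionFree)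
    (hW : Wuthrich2014.sha_dvd_analyticSha) (hCassels : bsdRHS_eq_of_isIsogenous)
    (hmodP : nonempty_modularParametrizationData) (hmod : exists_isNewformOf)
    (hGZQ : GrossZagier1986_thm_I_7_3)
    (hGZ : ∀ (N : ℕ) [NeZero N] (W : WeierstrassCurve ℚ) (K : Type) [Field K] [NumberField K],
      gross_zagier N W K)
    (hKo : ∀ (N : ℕ) [NeZero N] (W : WeierstrassCurve ℚ) (K : Type) [Field K] [NumberField K],
      kolyvagin N W K)
    (hGZK : rank_eq_analyticRank_of_analyticRank_le_one)
    (hW16 : Wuthrich2014.charIdeal_dvd_padicLFunction) (hGr : greenberg_charValue_rankZero)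
    (V : WeierstrassCurve ℚ) [V.IsElliptic] [V.IsGloballyMinimal] (hL : RankZero.Leaf V p)
    (W : WeierstrassCurve ℚ) [W.IsElliptic] [W.IsGloballyMinimal] (hiso : IsIsogenous V W)
    (hGL : ∀ Φ : AddSubgroup (geomTorsion W (p : ℤ)), IsRationalLine W p Φ → ¬ LineUnramifiedAt W p Φ)
    (hDT : DoubleTwistPartnerAt W p) : MazurMainConjecture V p :=
  (RankZero.Leaf.mazurMainConjecture_iff_bsdp hW16 hGr hmodP hGZK hL).mpr
    (Leaf.bsdp_of_isIsogenous_goodLattice_of_h308_of_doubleTwistPartnerAt h308 h511 hW hCassels hmodP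
      hmod hGZQ hGZ hKo hGZK V hL W hiso hGL hDT)

/-! ## §2 The class-wide rider and the leaf statement from `h308` + the rider -/

/-- **RIDER (TYPED; nothing asserted): every rank-`0` leaf pair has a good lattice carrying the
double-twist certificate.** For every leaf pair `(E,p)` (X1, `r_an = 0`) there is a globally minimal
`E' ∼ E` over `ℚ` with no rational `p`-line unramified at `p` (Ribet's normalisation — such `E'`
exist, `GoodLatticeExists`) and `DoubleTwistPartnerAt E' p`. CLASS-WIDE THIS IS NOT IN PRINT: it is an
indivisibility statement for the algebraic central values of REAL quadratic twists of `E'` by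
products `d_K d_{K'}` of two admissible discriminants (nearest print: Vatsal, Duke Math. J. 98 (1999),
Eisenstein congruences ⇒ `p`-unit twisted values for semistable curves with a rational `p`-torsion
point; Ono–Skinner, Ann. of Math. 147 (1998), all but finitely many `p`; Beckwith–Raum–Richter IMRN
2024, class numbers prime to `ℓ` with prescribed splitting); per pair it is a finite computation. In
route `EisensteinPrimes` it can stand in for crux 6 `SchneiderOnX1TypeB` on row A3 (companion
`Theorems/EisensteinPrimesMazurMCOnX1RankZeroDoubleTwist.lean`). [cite: Wuthrich2014, Prop. 21 (p. 400)]
[cite: KellerYin2024, proof of Thm. 4.2.1 (the display; nothing asserted)] -/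
@[conjecture] def DoubleTwistShaAnUnitSupply : Prop :=
  ∀ (V : WeierstrassCurve ℚ) [V.IsElliptic] [V.IsGloballyMinimal] (p : ℕ) [Fact p.Prime],
    RankZero.Leaf V p →
    ∃ (W : WeierstrassCurve ℚ) (_ : W.IsElliptic) (_ : W.IsGloballyMinimal), IsIsogenous V W ∧
      (∀ Φ : AddSubgroup (geomTorsion W (p : ℤ)), IsRationalLine W p Φ → ¬ LineUnramifiedAt W p Φ) ∧
      DoubleTwistPartnerAt W p

/-- **`BSD(E,p)` at EVERY rank-`0` leaf pair from `h308` + the rider + PUB** (no Schneider, no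
Greenberg–Vatsal, no `p`-adic height, no cyclotomic main conjecture at type A).
[claim: KellerYin2024, status: under-review] [cite: KellerYin2024, Thm. 3.0.8 (IMC2)]
[cite: Wuthrich2014, Prop. 21 (p. 400)] [cite: CastellaGrossiLeeSkinner2022, Thm. 5.3.1 and its proof] -/
theorem Leaf.bsdp_of_h308_of_doubleTwistSupply
    (h308 : thm308_imc2_bdpValue_goodLattice_OPEN) (hSupply : DoubleTwistShaAnUnitSupply)
    (h511 : thm511_anticyclotomicControl_of_torsionFree)
    (hW : Wuthrich2014.sha_dvd_analyticSha) (hCassels : bsdRHS_eq_of_isIsogenous)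
    (hmodP : nonempty_modularParametrizationData) (hmod : exists_isNewformOf)
    (hGZQ : GrossZagier1986_thm_I_7_3)
    (hGZ : ∀ (N : ℕ) [NeZero N] (W : WeierstrassCurve ℚ) (K : Type) [Field K] [NumberField K],
      gross_zagier N W K)
    (hKo : ∀ (N : ℕ) [NeZero N] (W : WeierstrassCurve ℚ) (K : Type) [Field K] [NumberField K],
      kolyvagin N W K)
    (hGZK : rank_eq_analyticRank_of_analyticRank_le_one)
    (V : WeierstrassCurve ℚ) [V.IsElliptic] [V.IsGloballyMinimal] (hL : RankZero.Leaf V p) :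
    BSDp V p := by
  obtain ⟨W, _, _, hiso, hGL, hDT⟩ := hSupply V p hL
  exact Leaf.bsdp_of_isIsogenous_goodLattice_of_h308_of_doubleTwistPartnerAt h308 h511 hW hCassels hmodP
    hmod hGZQ hGZ hKo hGZK V hL W hiso hGL hDT

/-- **Mazur's main conjecture at EVERY rank-`0` leaf pair from `h308` + the rider + PUB**
(+ Wuthrich Thm. 16, Greenberg Thm. 4.1 for the converse chain). This is the body of crux 5
`MazurMCOnX1RankZero` of route `EisensteinPrimes` (by-name corollary in the companion Theorems file).
[claim: KellerYin2024, status: under-review] [cite: KellerYin2024, Thm. 3.0.8 (IMC2)]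
[cite: Wuthrich2014, Thm. 16 (p. 397), Prop. 21 (p. 400)] [cite: GreenbergLNM1716, Thm. 4.1] -/
theorem Leaf.mazurMainConjecture_of_h308_of_doubleTwistSupply
    (h308 : thm308_imc2_bdpValue_goodLattice_OPEN) (hSupply : DoubleTwistShaAnUnitSupply)
    (h511 : thm511_anticyclotomicControl_of_torsionFree)
    (hW : Wuthrich2014.sha_dvd_analyticSha) (hCassels : bsdRHS_eq_of_isIsogenous)
    (hmodP : nonempty_modularParametrizationData) (hmod : exists_isNewformOf)
    (hGZQ : GrossZagier1986_thm_I_7_3)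
    (hGZ : ∀ (N : ℕ) [NeZero N] (W : WeierstrassCurve ℚ) (K : Type) [Field K] [NumberField K],
      gross_zagier N W K)
    (hKo : ∀ (N : ℕ) [NeZero N] (W : WeierstrassCurve ℚ) (K : Type) [Field K] [NumberField K],
      kolyvagin N W K)
    (hGZK : rank_eq_analyticRank_of_analyticRank_le_one)
    (hW16 : Wuthrich2014.charIdeal_dvd_padicLFunction) (hGr : greenberg_charValue_rankZero)
    (V : WeierstrassCurve ℚ) [V.IsElliptic] [V.IsGloballyMinimal] (hL : RankZero.Leaf V p) :
    MazurMainConjecture V p :=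
  (RankZero.Leaf.mazurMainConjecture_iff_bsdp hW16 hGr hmodP hGZK hL).mpr
    (Leaf.bsdp_of_h308_of_doubleTwistSupply h308 hSupply h511 hW hCassels hmodP hmod hGZQ hGZ hKo hGZK V
      hL)

/-- **The sub-cell statement `X1.RankZero.Statement`** (`BSD(E,p)` at every rank-`0` leaf pair) from
`h308` + the rider + PUB. [claim: KellerYin2024, status: under-review]
[cite: KellerYin2024, Thm. 3.0.8 (IMC2)] [cite: Wuthrich2014, Prop. 21 (p. 400)] -/
theorem statement_of_h308_of_doubleTwistSupply
    (h308 : thm308_imc2_bdpValue_goodLattice_OPEN) (hSupply : DoubleTwistShaAnUnitSupply)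
    (h511 : thm511_anticyclotomicControl_of_torsionFree)
    (hW : Wuthrich2014.sha_dvd_analyticSha) (hCassels : bsdRHS_eq_of_isIsogenous)
    (hmodP : nonempty_modularParametrizationData) (hmod : exists_isNewformOf)
    (hGZQ : GrossZagier1986_thm_I_7_3)
    (hGZ : ∀ (N : ℕ) [NeZero N] (W : WeierstrassCurve ℚ) (K : Type) [Field K] [NumberField K],
      gross_zagier N W K)
    (hKo : ∀ (N : ℕ) [NeZero N] (W : WeierstrassCurve ℚ) (K : Type) [Field K] [NumberField K],
      kolyvagin N W K)
    (hGZK : rank_eq_analyticRank_of_analyticRank_le_one) : RankZero.Statement :=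
  fun V _ _ _ _ hLq ↦ Leaf.bsdp_of_h308_of_doubleTwistSupply h308 hSupply h511 hW hCassels hmodP hmod
    hGZQ hGZ hKo hGZK V hLq

end Summit.BirchSwinnertonDyer.Rank1Residual.X1.RankZeroDoubleTwistClass

end
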